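import Summits.CriticalPhenomena.PercolationContinuityZ3.Theorems.PercNearOneGluingNoHeavyPcintDefectDiagrams
import Summits.CriticalPhenomena.PercolationContinuityZ3.Theorems.PercNearOneGluingNoHeavyPcintSignedConfigs
import HarnessLib

/-!
# CriticalPhenomena/PercolationContinuityZ3 — Theorems/PercNearOneGluingNoHeavyPcintOneDefectBridge.lean: one-defect structures ARE the top signed configurations with four letters `+ ± ± ±` (two of each sign)

Lane prim-pcint, STRUCTURE rule «numerics ⇒ structure ⇒ conjecture» (prim-pcint-2 GEN 22).  The bridge between …PcintDefectDiagrams and the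
forest decomposition (…PcintSignedConfigs…): a one-defect structure `(π, a, b)` (a chord diagram with a marked pair of chords whose two switched
diagrams are irreducible) is the same thing as a signed configuration with exactly four letters, two of sign `+` (the chord `{a, π a}`) and two
of sign `−` (the chord `{b, π b}`), the least letter positive, and no PROPER closed interval of weight zero: `toCfg` replaces the marked chords by
signed letters, and by `closed_switch_or_iff` a block is closed for one of the switched diagrams iff it is closed with weight zero
(`propSAW_toCfg_iff`).  Counting: `#defectSet α = #D α` (`card_defectSet_eq_card_dSet`) where `dSet` is that class of configurations; its sign
word is one of `+−+−`, `++−−`, `+−−+` (sequel).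

HONEST FRAMING: elementary finite combinatorics.  No `sorry`; standard axioms.  Written by prim-pcint-2 gen 22 (prover-prim-pcint-2-g22-0), 2026-08-27.
-/

namespace Summit.CriticalPhenomena.PercolationContinuityZ3.Theorems.Pcint.ChordDiag

variable {α : Type*} [LinearOrder α] [Fintype α]

/-! ### From a one-defect structure to a signed configuration -/

/-- The configuration of a one-defect structure: `π` off the 4-block (identity on it), signs `+` on `{a, π a}`. [folklore] -/
def toCfg (t : (α → α) × α × α) : Cfg α :=
  (fun x => if x ∈ quad t.1 t.2.1 t.2.2 then x else t.1 x, fun x => decide (x = t.2.1 ∨ x = t.1 t.2.1))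

section ToCfg

variable {π : α → α} {a b : α}

omit [Fintype α] in
/-- The map of `toCfg` on the 4-block. [folklore] -/
theorem toCfg_fst_of_mem {x : α} (hx : x ∈ quad π a b) : (toCfg (π, a, b)).1 x = x := by
  simp [toCfg, hx]

omit [Fintype α] in
/-- The map of `toCfg` off the 4-block. [folklore] -/
theorem toCfg_fst_of_not_mem {x : α} (hx : x ∉ quad π a b) : (toCfg (π, a, b)).1 x = π x := by
  simp [toCfg, hx]

omit [Fintype α] in
/-- The sign of `toCfg`. [folklore] -/
theorem toCfg_snd (x : α) : (toCfg (π, a, b)).2 x = decide (x = a ∨ x = π a) := rfl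

omit [Fintype α] in
/-- The letters of `toCfg` are the 4-block. [folklore] -/
theorem toCfg_letter_iff (hd : IsDiag π) (x : α) : (toCfg (π, a, b)).1 x = x ↔ x ∈ quad π a b := by
  by_cases hx : x ∈ quad π a b
  · rw [toCfg_fst_of_mem hx]; simp [hx]
  · rw [toCfg_fst_of_not_mem hx]; simp only [hx, iff_false]; exact (hd x).2

omit [Fintype α] in
/-- `toCfg` is well formed. [folklore] -/
theorem isCfg_toCfg (hd : IsDiag π) (hp : IsPair π a b) : IsCfg (toCfg (π, a, b)) := by
  refine ⟨fun x => ?_, fun x hx => ?_⟩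
  · by_cases hx : x ∈ quad π a b
    · rw [toCfg_fst_of_mem hx, toCfg_fst_of_mem hx]
    · have hx' : π x ∉ quad π a b := fun h => hx ((mem_quad_apply hd).1 h)
      rw [toCfg_fst_of_not_mem hx, toCfg_fst_of_not_mem hx']
      exact (hd x).1
  · have hx' : x ∉ quad π a b := fun h => hx ((toCfg_letter_iff hd x).2 h)
    rw [toCfg_snd, decide_eq_false_iff_not]
    rintro (rfl | rfl)
    · exact hx' (mem_quad.2 (Or.inl rfl))
    · exact hx' (mem_quad.2 (Or.inr (Or.inl rfl)))

/-- The letters of `toCfg`. [folklore] -/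
theorem letters_toCfg (hd : IsDiag π) : letters (toCfg (π, a, b)) = quad π a b := by
  ext x; rw [mem_letters, toCfg_letter_iff hd]

omit [Fintype α] in
/-- Closed sets of `toCfg`: `π`-closed off the 4-block. [folklore] -/
theorem closed_toCfg_iff (I : Finset α) : Closed (toCfg (π, a, b)).1 I ↔ ∀ x, x ∉ quad π a b → x ∈ I → π x ∈ I := by
  constructor
  · intro h x hx hxI
    have := h hxI
    rwa [toCfg_fst_of_not_mem hx] at this
  · intro h x hxI
    by_cases hx : x ∈ quad π a b
    · rw [toCfg_fst_of_mem hx]; exact hxI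
    · rw [toCfg_fst_of_not_mem hx]; exact h x hx hxI

omit [Fintype α] in
/-- Point weights of `toCfg`: `+1` on `a, π a`, `−1` on `b, π b`, `0` elsewhere. [folklore] -/
theorem sgn_toCfg (hd : IsDiag π) (hp : IsPair π a b) (x : α) :
    sgn (toCfg (π, a, b)) x = (if x = a then 1 else 0) + (if x = π a then 1 else 0) - (if x = b then 1 else 0) - (if x = π b then 1 else 0) := by
  obtain ⟨d1, d2, d3, d4, d5, d6⟩ := hp.distinct hd
  unfold sgn
  by_cases hx : x ∈ quad π a b
  · rw [if_pos ((toCfg_letter_iff hd x).2 hx), toCfg_snd]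
    rcases mem_quad.1 hx with rfl | rfl | rfl | rfl
    · simp [d1, d3, d5]
    · simp [Ne.symm d1, Ne.symm d4, d6]
    · simp [d3.symm, d4, d2]
    · simp [Ne.symm d5, Ne.symm d6, Ne.symm d2]
  · rw [if_neg (fun h => hx ((toCfg_letter_iff hd x).1 h))]
    rw [mem_quad] at hx
    push Not at hx
    simp [hx.1, hx.2.1, hx.2.2.1, hx.2.2.2]

omit [Fintype α] in
/-- **The weight of a set is the signed count on the 4-block**: `wt I = qcount a (π a) I − qcount b (π b) I`. [folklore] -/
theorem wt_toCfg (hd : IsDiag π) (hp : IsPair π a b) (I : Finset α) :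
    wt (toCfg (π, a, b)) I = (qcount a (π a) I : ℤ) - (qcount b (π b) I : ℤ) := by
  unfold wt qcount
  simp only [sgn_toCfg hd hp, Finset.sum_sub_distrib, Finset.sum_add_distrib, Finset.sum_ite_eq', Nat.cast_add, Nat.cast_ite,
    Nat.cast_one, Nat.cast_zero]
  ring

/-- **No proper closed interval of weight zero iff both switched diagrams are irreducible.** [folklore] -/
theorem propSAW_toCfg_iff (hd : IsDiag π) (hp : IsPair π a b) :
    PropSAW (toCfg (π, a, b)) ↔ IsGood (switchP π a b) ∧ IsGood (switchX π a b) := by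
  have key : ∀ I : Finset α, (Closed (switchP π a b) I ∨ Closed (switchX π a b) I) ↔
      (Closed (toCfg (π, a, b)).1 I ∧ wt (toCfg (π, a, b)) I = 0) := by
    intro I
    rw [closed_switch_or_iff hd hp, closed_toCfg_iff, wt_toCfg hd hp, sub_eq_zero, Nat.cast_inj]
    rfl
  constructor
  · intro h
    refine ⟨⟨isDiag_switchP hd hp, fun I hcv hcl => ?_⟩, ⟨isDiag_switchX hd hp, fun I hcv hcl => ?_⟩⟩
    · obtain ⟨hc, hw⟩ := (key I).1 (Or.inl hcl)
      by_contra hne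
      push Not at hne
      exact h I hne.1 hne.2 hcv hc hw
    · obtain ⟨hc, hw⟩ := (key I).1 (Or.inr hcl)
      by_contra hne
      push Not at hne
      exact h I hne.1 hne.2 hcv hc hw
  · rintro ⟨hP, hX⟩ I hne hnu hcv hcl hw
    rcases (key I).2 ⟨hcl, hw⟩ with h | h
    · rcases hP.2 I hcv h with h0 | h1
      · exact hne.ne_empty h0
      · exact hnu h1
    · rcases hX.2 I hcv h with h0 | h1
      · exact hne.ne_empty h0
      · exact hnu h1

end ToCfg

/-! ### The class of configurations of one-defect structures -/

/-- The configurations of one-defect structures: well formed, four letters, two of them positive including the least letter, no proper closed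
interval of weight zero. [folklore] -/
def IsDCfg (c : Cfg α) : Prop :=
  IsCfg c ∧ PropSAW c ∧ (letters c).card = 4 ∧ ((letters c).filter fun x => c.2 x = true).card = 2 ∧
    ∀ x ∈ letters c, (∀ y ∈ letters c, x ≤ y) → c.2 x = true

open Classical in
/-- The finite set of configurations of one-defect structures. [folklore] -/
noncomputable def dSet (α : Type*) [LinearOrder α] [Fintype α] : Finset (Cfg α) := Finset.univ.filter fun c => IsDCfg c

/-- Membership in `dSet`. [folklore] -/
theorem mem_dSet {c : Cfg α} : c ∈ dSet α ↔ IsDCfg c := by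
  simp [dSet]

section Image

variable {π : α → α} {a b : α}

/-- The positive letters of `toCfg` are `a, π a`. [folklore] -/
theorem filter_letters_toCfg (hd : IsDiag π) (hp : IsPair π a b) :
    ((letters (toCfg (π, a, b))).filter fun x => (toCfg (π, a, b)).2 x = true) = {a, π a} := by
  obtain ⟨d1, d2, d3, d4, d5, d6⟩ := hp.distinct hd
  ext x
  rw [Finset.mem_filter, letters_toCfg hd, toCfg_snd, decide_eq_true_eq, mem_quad, Finset.mem_insert, Finset.mem_singleton]
  constructor
  · rintro ⟨-, h⟩; exact h
  · rintro (rfl | rfl)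
    · exact ⟨Or.inl rfl, Or.inl rfl⟩
    · exact ⟨Or.inr (Or.inl rfl), Or.inr rfl⟩

omit [Fintype α] in
/-- `a` is the least point of the 4-block. [folklore] -/
theorem le_of_mem_quad (hp : IsPair π a b) {y : α} (hy : y ∈ quad π a b) : a ≤ y := by
  obtain ⟨h1, h2, h3, -⟩ := hp
  rcases mem_quad.1 hy with rfl | rfl | rfl | rfl
  · exact le_rfl
  · exact h1.le
  · exact h3.le
  · exact (h3.trans h2).le

/-- **A one-defect structure gives a configuration of `dSet`.** [folklore] -/
theorem isDCfg_toCfg {t : (α → α) × α × α} (ht : t ∈ defectSet α) : IsDCfg (toCfg t) := by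
  obtain ⟨π, a, b⟩ := t
  obtain ⟨hd, hp, hP, hX⟩ := mem_defectSet.1 ht
  obtain ⟨d1, d2, d3, d4, d5, d6⟩ := hp.distinct hd
  refine ⟨isCfg_toCfg hd hp, (propSAW_toCfg_iff hd hp).2 ⟨hP, hX⟩, ?_, ?_, fun x hx hmin => ?_⟩
  · rw [letters_toCfg hd]
    unfold quad
    rw [Finset.card_insert_of_notMem (by simp [d1, d3, d5]), Finset.card_insert_of_notMem (by simp [Ne.symm d4, d6]),
      Finset.card_pair (Ne.symm d2).symm]
  · rw [filter_letters_toCfg hd hp, Finset.card_pair d1]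
  · rw [letters_toCfg hd] at hx hmin
    have hxa : x = a := le_antisymm (hmin a (mem_quad.2 (Or.inl rfl))) (le_of_mem_quad hp hx)
    rw [toCfg_snd, hxa]; simp

end Image

end Summit.CriticalPhenomena.PercolationContinuityZ3.Theorems.Pcint.ChordDiag
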